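import Summits.Langlands.Langlands.Theses.QuarterDeficit1951

/-!
# Sketch — crux ideas of ideator 3 (round 1) on `CensusDeficit1951` (stmt-Langlands-17933)

First lemmas (over existing declarations) for two negation-direction crux ideas:

* `blend-dont-mollify` (two-cusp partition-of-unity quasimode): its enabling geometric fact is
  `twoCuspFloor` — every point of `ℍ` has a `Γ₀(1951)`-translate whose height, or whose height in the
  Fricke-conjugate cusp coordinate (`Im w / |w|²`, i.e. the height of `S • w`, which is `1951 ×` the
  height of `W₁₉₅₁ w`), is `≥ √3/2` — so the two cusp expansions of a level-1951 form, truncated for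
  heights `≥ √3/(2·1951)`, cover the surface with an `O(1)`-wide (hyperbolic) overlap and can be
  glued by a smooth partition of unity over lifts (no mollifier radius). PROVED below.
* `hecke-penalised-ground-state` (variational certificate): its abstract core is
  `penalised_pigeonhole` (a Rayleigh-quotient bound for a diagonal quadratic form forces one diagonal
  entry below the bound on the support of the trial vector) and the fingerprint arithmetic
  `fingerprint_of_close` (Hecke eigenvalue within `d` of an icosahedral value `a`, `|a| ≤ 2`, gives
  the fingerprint quantity within `d(4+d)`). Both PROVED below.

The typed obstruction both ideas plug into is already in the crux directory:
`BsvQuasimodeSighting.not_censusDeficit1951_of_fingerprinted_form` (proved there).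
-/

namespace Summit.Langlands.Langlands.Cruxes.CensusDeficit1951.Ideator3Sketch

open scoped MatrixGroups
open ModularGroup UpperHalfPlane

/-- Entry `(1,0)` of `S⁻¹ Tᵏ g` is `-(g₀₀) - k g₁₀`. [folklore] -/
theorem S_inv_T_zpow_mul_apply_10 (k : ℤ) (g : SL(2, ℤ)) :
    (S⁻¹ * T ^ k * g) 1 0 = -(g 0 0) - k * g 1 0 := by
  simp [Matrix.SpecialLinearGroup.coe_mul, Matrix.SpecialLinearGroup.coe_inv,
    ModularGroup.coe_T_zpow, ModularGroup.coe_S, Matrix.adjugate_fin_two_of, Matrix.mul_apply,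
    Fin.sum_univ_two]
  ring

/-- **Two-cusp floor for `Γ₀(1951)` (enabling lemma of `blend-dont-mollify`).** Every `z : ℍ`
has a `Γ₀(1951)`-translate `w = γ • z` with `3 ≤ 4 (Im w)²` (height `≥ √3/2` in the cusp `∞`)
or `3 ≤ 4 (Im w / |w|²)²` (height `≥ √3/2` after `S`, i.e. height `≥ √3/(2·1951)` in the
unit-width coordinate of the cusp `0`, `W₁₉₅₁ w = S(1951 w)`). Proof: move `z` into the standard
fundamental domain by `g ∈ SL₂(ℤ)`; if `1951 ∣ g₁₀` then `g ∈ Γ₀(1951)`; otherwise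
`γ := S⁻¹ Tᵏ g ∈ Γ₀(1951)` for `k ≡ -g₀₀ g₁₀⁻¹ (mod 1951)` and `S γ z = Tᵏ g z` has the height
of `g z`. [folklore] -/
theorem twoCuspFloor (z : ℍ) :
    ∃ γ : SL(2, ℤ), γ ∈ CongruenceSubgroup.Gamma0 1951 ∧
      (3 ≤ 4 * (γ • z).im ^ 2 ∨
        3 ≤ 4 * ((γ • z).im / Complex.normSq ((γ • z : ℍ) : ℂ)) ^ 2) := by
  obtain ⟨g, hg⟩ := ModularGroup.exists_smul_mem_fd z
  have him := ModularGroup.three_le_four_mul_im_sq_of_mem_fd hg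
  by_cases hc : ((g 1 0 : ℤ) : ZMod 1951) = 0
  · exact ⟨g, CongruenceSubgroup.Gamma0_mem.mpr (by exact_mod_cast hc), Or.inl him⟩
  · haveI : Fact (Nat.Prime 1951) := ⟨by norm_num⟩
    -- k ≡ -a c⁻¹ (mod 1951)
    set a : ZMod 1951 := ((g 0 0 : ℤ) : ZMod 1951) with ha
    set c : ZMod 1951 := ((g 1 0 : ℤ) : ZMod 1951) with hcdef
    let k : ℤ := ((-a * c⁻¹ : ZMod 1951).val : ℤ)
    have hk : ((k : ℤ) : ZMod 1951) = -a * c⁻¹ := by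
      simp [k, ZMod.natCast_val, ZMod.cast_id]
    refine ⟨S⁻¹ * T ^ k * g, ?_, Or.inr ?_⟩
    · rw [CongruenceSubgroup.Gamma0_mem, S_inv_T_zpow_mul_apply_10]
      push_cast
      rw [hk, ← ha, ← hcdef]
      field_simp
      ring
    · -- height after `S`: `S • (S⁻¹ Tᵏ g) • z = Tᵏ • g • z`, same height as `g • z`
      have hS : (S • ((S⁻¹ * T ^ k * g) • z)).im = (g • z).im := by
        rw [← mul_smul, ← mul_assoc, ← mul_assoc, mul_inv_cancel, one_mul, mul_smul,
          UpperHalfPlane.modular_T_zpow_smul, UpperHalfPlane.vadd_im]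
      have hS' : (S • ((S⁻¹ * T ^ k * g) • z)).im =
          ((S⁻¹ * T ^ k * g) • z).im / Complex.normSq ((((S⁻¹ * T ^ k * g) • z : ℍ)) : ℂ) := by
        rw [ModularGroup.im_smul_eq_div_normSq, ModularGroup.denom_S]
      rw [← hS', hS]
      exact him

/-- **Penalised-ground-state pigeonhole (abstract core of `hecke-penalised-ground-state`).**
If nonnegative masses `m i` (the squared coefficients `|⟨b i, v⟩|²` of a trial vector against a
joint eigenbasis) have total mass `M > 0` and the diagonal quadratic form `Σ w i · m i` (the
quadratic form of the penalised operator `-Δ + Σ_p c_p |T̃_p - t_p|²`, diagonal with entries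
`w i = λ_i + Σ_p c_p |t̃_{p,i} - t_p|²`) is `≤ η · M`, then some index in the support of the
trial vector has `w i ≤ η` — the min–max / Rayleigh-quotient principle in coordinates. [folklore] -/
theorem penalised_pigeonhole {ι : Type*} (w m : ι → ℝ) (η M Q : ℝ)
    (hm : ∀ i, 0 ≤ m i) (hM : HasSum m M) (hMpos : 0 < M)
    (hQ : HasSum (fun i => w i * m i) Q) (hle : Q ≤ η * M) :
    ∃ i, 0 < m i ∧ w i ≤ η := by
  by_contra h
  push Not at h
  have h1 : ∀ i, η * m i ≤ w i * m i := fun i => by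
    rcases (hm i).lt_or_eq with hpos | hzero
    · exact mul_le_mul_of_nonneg_right (h i hpos).le (hm i)
    · rw [← hzero]; simp
  have hηM : HasSum (fun i => η * m i) (η * M) := hM.mul_left η
  obtain ⟨i, hi⟩ : ∃ i, 0 < m i := by
    by_contra h0
    push Not at h0
    have hzero : m = fun _ => 0 := funext fun i => le_antisymm (h0 i) (hm i)
    have : M = 0 := by
      rw [hzero] at hM
      exact hM.unique hasSum_zero
    exact hMpos.ne' this
  have hlt : η * m i < w i * m i := mul_lt_mul_of_pos_right (h i hi) hi
  have : η * M < Q := hasSum_lt h1 hlt hηM hQ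
  linarith

/-- **Fingerprint arithmetic.** If a Hecke eigenvalue `μ` is within `d` of an icosahedral value `a`
with `|a| ≤ 2` (finite image: `|tr ρ(Frob_p)| ≤ 2`), then for any unimodular `c` (here
`c = conj χ(p)`) the fingerprint quantities differ by at most `d (4 + d)`; e.g. `d ≤ 1/410` gives
`≤ 1/100`, the crux tolerance. [folklore] -/
theorem fingerprint_of_close (μ a c : ℂ) (d : ℝ) (hd : ‖μ - a‖ ≤ d) (ha : ‖a‖ ≤ 2)
    (hc : ‖c‖ = 1) : ‖μ ^ 2 * c - a ^ 2 * c‖ ≤ d * (4 + d) := by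
  have h0 : 0 ≤ d := (norm_nonneg _).trans hd
  have hfac : μ ^ 2 * c - a ^ 2 * c = (μ - a) * (μ + a) * c := by ring
  rw [hfac, norm_mul, norm_mul, hc, mul_one]
  have h2 : ‖μ + a‖ ≤ d + 4 := by
    have : μ + a = (μ - a) + 2 * a := by ring
    calc ‖μ + a‖ = ‖(μ - a) + 2 * a‖ := by rw [this]
      _ ≤ ‖μ - a‖ + ‖(2 : ℂ) * a‖ := norm_add_le _ _
      _ ≤ d + 4 := by
        rw [norm_mul, Complex.norm_two]
        linarith
  calc ‖μ - a‖ * ‖μ + a‖ ≤ d * (d + 4) := mul_le_mul hd h2 (norm_nonneg _) h0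
    _ = d * (4 + d) := by ring

/-- The crux tolerance instance: `d = 1/410` suffices (`(1/410)(4 + 1/410) ≤ 1/100`). [folklore] -/
theorem fingerprint_of_close_crux (μ a c : ℂ) (hd : ‖μ - a‖ ≤ 1 / 410) (ha : ‖a‖ ≤ 2)
    (hc : ‖c‖ = 1) : ‖μ ^ 2 * c - a ^ 2 * c‖ ≤ 1 / 100 :=
  (fingerprint_of_close μ a c (1 / 410) hd ha hc).trans (by norm_num)

end Summit.Langlands.Langlands.Cruxes.CensusDeficit1951.Ideator3Sketch
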